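import Mathlib.FieldTheory.Finite.Basic
import Mathlib.GroupTheory.Perm.Cycle.Type
import Mathlib.RingTheory.DedekindDomain.Factorization
import Mathlib.LinearAlgebra.FreeModule.IdealQuotient
import Mathlib.NumberTheory.NumberField.Basic
import Literature.NumberTheory.QuadraticForms.HilbertSymbol
import Literature.RingTheory.DiscreteValuationRing.AdicCompletionHensel
import HarnessLib

/-!
# The Hilbert symbol at non-dyadic places; finiteness half of Hilbert reciprocity

Topic `NumberTheory/QuadraticForms`; namespace `Literature`. Companion ("proofs") file of
`HilbertSymbol.lean`; every declaration here is a fully proved theorem.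

* `hilbertSymbol_mul_sq_left`, `hilbertSymbol_mul_sq_right` : the Hilbert symbol `(a, b)_F` only
  depends on the square classes of `a` and `b` (O'Meara §63B).
* `hilbertSymbol_eq_one_of_not_mem` : **O'Meara, Example 63:12** ("let `ε, δ` be units in a given
  non-dyadic local field; then `(ε, δ)_𝔭 = 1` always"), in the case of global units: for a
  Dedekind domain `A` with fraction field `K`, a finite place `v` with finite residue field and
  `2 ∉ v`, and `a b ∈ A ∖ v`, the symbol `(a, b)_v` computed in `K_v = v.adicCompletion K` is `1`.
  Proof along the lines of O'Meara 63:11a: a regular binary form over a finite field of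
  characteristic `≠ 2` is universal (62:1; here `a x² + b y² = 1` is solved in the finite
  residue ring `A ⧸ v` of odd cardinality by Mathlib's counting lemma
  `FiniteField.exists_root_sum_quadratic`), and a solution with, say, `x ∉ v` lifts to `O_v`
  (O'Meara: Local Square Theorem 63:1; here Hensel's lemma applied to `a X² + (b y² - 1)`, whose
  derivative `2 a x` is a `v`-unit
  (`HenselianLocalRing.exists_isRoot_of_isUnit_derivative` and the instance
  `adicCompletionIntegers.henselianLocalRing` of
  `Literature/RingTheory/DiscreteValuationRing/AdicCompletionHensel.lean`).
* `finite_setOf_hilbertSymbol_eq_neg_one` : **O'Meara, Thm. 71:18, first assertion** ("their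
  Hilbert symbol is `1` for almost all `𝔭`"): for non-zero `a b` in a number field `K` the set of
  finite places `v` with `(a, b)_v = -1` is finite — the first conjunct of the named fact
  `hilbertReciprocity K a b` of `HilbertSymbol.lean`, now proved. (Replace `a, b` by integral
  representatives of their square classes; then every `v` not dividing `2ab` is as in 63:12.)

The second assertion of 71:18, the product formula `∏_v (a, b)_v = 1` (evenness of the number of
places with symbol `-1`), is the class-field-theoretic content of Hilbert reciprocity and is not
proved here.

## Mathlib searches

`FiniteField.exists_root_sum_quadratic`, `exists_prime_addOrderOf_dvd_card`,
`Ideal.finite_factors`, `Ideal.finiteQuotientOfFreeOfNeBot`, `IsFractionRing.div_surjective`,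
`HeightOneSpectrum.adicCompletionIntegers.isUnit_iff_valued_eq_one` are in Mathlib; Mathlib has
no Hilbert symbol and (at the pin) no Hensel lemma for `v.adicCompletionIntegers K` (supplied by
the Literature file cited above).

## References

* O. T. O'Meara, *Introduction to quadratic forms*, Grundlehren 117, Springer (1963), §63B
  (Example 63:12, PDF p. 170), §71 (Thm. 71:18, PDF p. 206).
* M.-F. Vignéras, *Arithmétique des algèbres de quaternions*, LNM 800 (1980), Ch. II §1
  (calcul du symbole de Hilbert), Ch. III §3 Cor. 3.3.
-/

noncomputable section

open NumberField IsDedekindDomain Polynomial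

namespace Literature.NumberTheory.QuadraticForms

/-! ### Square classes -/

section Field

variable {F : Type*} [Field F]

/-- `(a c², b)_F = (a, b)_F` for `c ≠ 0`: the Hilbert symbol only depends on square classes
(O'Meara §63B; substitute `x ↦ c x`). [folklore] -/
theorem hilbertSymbol_mul_sq_left (a b : F) {c : F} (hc : c ≠ 0) :
    hilbertSymbol F (a * c ^ 2) b = hilbertSymbol F a b := by
  have key : (∃ x y : F, a * c ^ 2 * x ^ 2 + b * y ^ 2 = 1) ↔
      ∃ x y : F, a * x ^ 2 + b * y ^ 2 = 1 := by
    constructor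
    · rintro ⟨x, y, h⟩
      exact ⟨c * x, y, by linear_combination h⟩
    · rintro ⟨x, y, h⟩
      refine ⟨x / c, y, ?_⟩
      field_simp
      linear_combination h
  by_cases h : ∃ x y : F, a * x ^ 2 + b * y ^ 2 = 1
  · rw [(hilbertSymbol_eq_one_iff _ _).2 (key.2 h), (hilbertSymbol_eq_one_iff _ _).2 h]
  · rw [(hilbertSymbol_eq_neg_one_iff _ _).2 fun h' ↦ h (key.1 h'),
      (hilbertSymbol_eq_neg_one_iff _ _).2 h]

/-- `(a, b c²)_F = (a, b)_F` for `c ≠ 0` (O'Meara §63B). [folklore] -/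
theorem hilbertSymbol_mul_sq_right (a b : F) {c : F} (hc : c ≠ 0) :
    hilbertSymbol F a (b * c ^ 2) = hilbertSymbol F a b := by
  rw [hilbertSymbol_comm, hilbertSymbol_mul_sq_left b a hc, hilbertSymbol_comm]

end Field

/-! ### Non-dyadic places: O'Meara 63:12 for global units -/

section Local

variable {A : Type*} [CommRing A] [IsDedekindDomain A] (K : Type*) [Field K] [Algebra A K]
  [IsFractionRing A K] (v : HeightOneSpectrum A)

/-- An element of `A` outside the prime `v` is a unit of the completed local ring
`O_v = v.adicCompletionIntegers K` (its valuation is `1`). [folklore] -/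
theorem isUnit_algebraMap_adicCompletionIntegers_of_not_mem {a : A} (ha : a ∉ v.asIdeal) :
    IsUnit (algebraMap A (v.adicCompletionIntegers K) a) := by
  rw [HeightOneSpectrum.adicCompletionIntegers.isUnit_iff_valued_eq_one]
  change Valued.v ((algebraMap A (v.adicCompletionIntegers K) a : v.adicCompletion K)) = 1
  rw [HeightOneSpectrum.algebraMap_adicCompletionIntegers_apply A K v a,
    HeightOneSpectrum.valuedAdicCompletion_eq_valuation', HeightOneSpectrum.valuation_of_algebraMap]
  exact HeightOneSpectrum.intValuation_eq_one_iff.mpr ha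

/-- An element of the prime `v` lies in the maximal ideal of `O_v` (its valuation is `< 1`).
[folklore] -/
theorem algebraMap_mem_maximalIdeal_adicCompletionIntegers_of_mem {a : A} (ha : a ∈ v.asIdeal) :
    algebraMap A (v.adicCompletionIntegers K) a ∈
      IsLocalRing.maximalIdeal (v.adicCompletionIntegers K) := by
  rw [IsLocalRing.mem_maximalIdeal, mem_nonunits_iff,
    HeightOneSpectrum.adicCompletionIntegers.isUnit_iff_valued_eq_one]
  change Valued.v ((algebraMap A (v.adicCompletionIntegers K) a : v.adicCompletion K)) ≠ 1
  rw [HeightOneSpectrum.algebraMap_adicCompletionIntegers_apply A K v a,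
    HeightOneSpectrum.valuedAdicCompletion_eq_valuation', HeightOneSpectrum.valuation_of_algebraMap]
  exact ((HeightOneSpectrum.intValuation_lt_one_iff_mem v a).mpr ha).ne

/-- **Hensel step.** If `2 ∉ v`, `a ∉ v`, `x₁ ∉ v` and `a x₁² + b y₁² ≡ 1 (mod v)` with
`a b x₁ y₁ ∈ A`, then `a x² + b y² = 1` is soluble in `K_v`: Hensel's lemma
(`HenselianLocalRing.exists_isRoot_of_isUnit_derivative` over the Henselian ring `O_v`) for
`f(X) = a X² + (b y₁² - 1)` at `X = x₁`, where `f(x₁) ∈ 𝔪_v` and `f'(x₁) = 2 a x₁ ∈ O_vˣ`.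
This is the lifting step of O'Meara's proof of 63:11a/63:12 (done there with the Local Square
Theorem 63:1). [cite: Omeara1963, §63 Example 63:12] -/
theorem exists_sq_add_sq_eq_one_adicCompletion_of_mem (h2 : (2 : A) ∉ v.asIdeal)
    {a b x₁ y₁ : A} (ha : a ∉ v.asIdeal) (hx₁ : x₁ ∉ v.asIdeal)
    (h : a * x₁ ^ 2 + b * y₁ ^ 2 - 1 ∈ v.asIdeal) :
    ∃ x y : v.adicCompletion K,
      algebraMap A (v.adicCompletion K) a * x ^ 2 + algebraMap A (v.adicCompletion K) b * y ^ 2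
        = 1 := by
  haveI : v.asIdeal.IsPrime := v.isPrime
  set O := v.adicCompletionIntegers K with hO
  set ι : A →+* O := algebraMap A O with hι
  set f : O[X] := C (ι a) * X ^ 2 + C (ι b * ι y₁ ^ 2 - 1) with hf
  have hf₁ : f.eval (ι x₁) = ι (a * x₁ ^ 2 + b * y₁ ^ 2 - 1) := by
    simp only [hf, eval_add, eval_mul, eval_C, eval_pow, eval_X]
    simp only [map_add, map_sub, map_mul, map_pow, map_one]
    ring
  have hf₂ : f.derivative.eval (ι x₁) = ι (2 * a * x₁) := by
    simp only [hf, derivative_add, derivative_C_mul_X_pow, derivative_C, add_zero, eval_mul,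
      eval_C, eval_pow, eval_X]
    simp only [map_mul, map_ofNat]
    push_cast
    ring
  have h2ax : 2 * a * x₁ ∉ v.asIdeal := fun hmem ↦
    ((Ideal.IsPrime.mem_or_mem ‹_› hmem).elim
      (fun h' ↦ (Ideal.IsPrime.mem_or_mem ‹_› h').elim h2 ha) hx₁)
  obtain ⟨x, hx, -⟩ := HenselianLocalRing.exists_isRoot_of_isUnit_derivative f (ι x₁)
    (hf₁ ▸ algebraMap_mem_maximalIdeal_adicCompletionIntegers_of_mem K v h)
    (hf₂ ▸ isUnit_algebraMap_adicCompletionIntegers_of_not_mem K v h2ax)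
  have hroot : ι a * x ^ 2 + (ι b * ι y₁ ^ 2 - 1) = 0 := by
    have := hx.eq_zero
    simpa only [hf, eval_add, eval_mul, eval_C, eval_pow, eval_X] using this
  refine ⟨algebraMap O (v.adicCompletion K) x, algebraMap A (v.adicCompletion K) y₁, ?_⟩
  have hroot' := congrArg (algebraMap O (v.adicCompletion K)) hroot
  simp only [map_add, map_sub, map_mul, map_pow, map_one, map_zero, hι,
    ← IsScalarTower.algebraMap_apply A O (v.adicCompletion K)] at hroot'
  linear_combination hroot'

/-- **The Hilbert symbol of units at a non-dyadic place is `1`** (O'Meara, Example 63:12: "let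
`ε, δ` be units in a given non-dyadic local field; then `(ε, δ)_𝔭 = 1` always"), for global
units: `A` a Dedekind domain with fraction field `K`, `v` a finite place of `A` with finite
residue field `A ⧸ v` and `2 ∉ v`, and `a b ∈ A ∖ v`; then `(a, b)_v = 1` in
`K_v = v.adicCompletion K`. Proof: `A ⧸ v` is a finite domain in which `2 ≠ 0`, hence of odd
cardinality, so `a x² + b y² = 1` has a solution mod `v` (`FiniteField.exists_root_sum_quadratic`);
one of `x, y` is `∉ v`, and Hensel's lemma in that variable
(`exists_sq_add_sq_eq_one_adicCompletion_of_mem`) lifts it to `K_v`.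
[cite: Omeara1963, §63 Example 63:12] -/
theorem hilbertSymbol_eq_one_of_not_mem [Finite (A ⧸ v.asIdeal)] (h2 : (2 : A) ∉ v.asIdeal)
    {a b : A} (ha : a ∉ v.asIdeal) (hb : b ∉ v.asIdeal) :
    hilbertSymbol (v.adicCompletion K) (algebraMap A _ a) (algebraMap A _ b) = 1 := by
  haveI : v.asIdeal.IsPrime := v.isPrime
  letI : Fintype (A ⧸ v.asIdeal) := Fintype.ofFinite _
  set k := A ⧸ v.asIdeal
  set π : A →+* k := Ideal.Quotient.mk v.asIdeal with hπ
  have hne : ∀ {r : A}, r ∉ v.asIdeal → π r ≠ 0 := fun hr h ↦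
    hr ((Ideal.Quotient.eq_zero_iff_mem).1 h)
  -- the finite domain `k = A ⧸ v` has `2 ≠ 0`, hence odd cardinality (an element of additive
  -- order `2` would be killed by `2`)
  have h2k : (2 : k) ≠ 0 := by rw [← map_ofNat π 2]; exact hne h2
  have hodd : Fintype.card k % 2 = 1 := by
    by_contra hev
    obtain ⟨g, hg⟩ := exists_prime_addOrderOf_dvd_card (G := k) 2
      (Nat.dvd_of_mod_eq_zero (Nat.mod_two_ne_one.1 hev))
    have hg0 : g ≠ 0 := by
      rintro rfl
      rw [addOrderOf_zero] at hg
      exact absurd hg (by norm_num)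
    have h2g : (2 : k) * g = 0 := by
      have h := addOrderOf_nsmul_eq_zero g
      rw [hg, nsmul_eq_mul, Nat.cast_ofNat] at h
      exact h
    rcases mul_eq_zero.1 h2g with h | h
    · exact h2k h
    · exact hg0 h
  -- a solution of `a x² + b y² = 1` modulo `v`
  have hdf : degree (C (π a) * X ^ 2) = 2 := by
    rw [degree_C_mul_X_pow 2 (hne ha)]; rfl
  have hdg : degree (C (π b) * X ^ 2 - C 1) = 2 := by
    rw [degree_sub_C, degree_C_mul_X_pow 2 (hne hb)]
    · rfl
    · rw [degree_C_mul_X_pow 2 (hne hb)]; exact zero_lt_two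
  obtain ⟨x₀, y₀, hxy⟩ := FiniteField.exists_root_sum_quadratic hdf hdg hodd
  obtain ⟨x₁, rfl⟩ := Ideal.Quotient.mk_surjective x₀
  obtain ⟨y₁, rfl⟩ := Ideal.Quotient.mk_surjective y₀
  have hmem : a * x₁ ^ 2 + b * y₁ ^ 2 - 1 ∈ v.asIdeal := by
    rw [← Ideal.Quotient.eq_zero_iff_mem]
    simp only [eval_sub, eval_mul, eval_C, eval_pow, eval_X, ← hπ] at hxy
    simp only [map_sub, map_add, map_mul, map_pow, map_one]
    linear_combination hxy
  -- lift it by Hensel in a variable whose approximate value is a `v`-unit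
  rw [hilbertSymbol_eq_one_iff]
  by_cases hx₁ : x₁ ∈ v.asIdeal
  · -- then `b y₁² ≡ 1`, so `y₁ ∉ v`: Hensel in `y`
    have hmem' : b * y₁ ^ 2 + a * x₁ ^ 2 - 1 ∈ v.asIdeal := by
      convert hmem using 1; ring
    have hy₁ : y₁ ∉ v.asIdeal := by
      intro hy
      have h1 : (1 : A) ∈ v.asIdeal := by
        have := sub_mem (add_mem (Ideal.mul_mem_left _ a (Ideal.pow_mem_of_mem _ hx₁ 2 two_pos))
          (Ideal.mul_mem_left _ b (Ideal.pow_mem_of_mem _ hy 2 two_pos))) hmem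
        convert this using 1; ring
      exact v.isPrime.ne_top ((Ideal.eq_top_iff_one _).2 h1)
    obtain ⟨y, x, h⟩ := exists_sq_add_sq_eq_one_adicCompletion_of_mem K v h2 hb hy₁ hmem'
    exact ⟨x, y, by linear_combination h⟩
  · exact exists_sq_add_sq_eq_one_adicCompletion_of_mem K v h2 ha hx₁ hmem

end Local

/-! ### Number fields: the symbol is `1` at almost all places -/

section NumberField

variable (K : Type*) [Field K] [NumberField K]

/-- Every non-zero `a ∈ K` is, up to a non-zero square, a non-zero algebraic integer:
`a c² ∈ 𝓞 K ∖ {0}` for some `c ≠ 0` (write `a = p/q` and take `c = q`). [folklore] -/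
theorem exists_mul_sq_eq_algebraMap {a : K} (ha : a ≠ 0) :
    ∃ (a₁ : 𝓞 K) (c : K), a₁ ≠ 0 ∧ c ≠ 0 ∧ a * c ^ 2 = algebraMap (𝓞 K) K a₁ := by
  obtain ⟨p, q, hq, rfl⟩ := IsFractionRing.div_surjective (A := 𝓞 K) a
  have hq0 : (algebraMap (𝓞 K) K q) ≠ 0 :=
    IsFractionRing.to_map_ne_zero_of_mem_nonZeroDivisors hq
  refine ⟨p * q, algebraMap (𝓞 K) K q, ?_, hq0, ?_⟩
  · refine mul_ne_zero ?_ (nonZeroDivisors.ne_zero hq)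
    rintro rfl
    exact ha (by simp)
  · rw [map_mul]
    field_simp

/-- A non-zero algebraic integer lies in only finitely many primes (Mathlib
`Ideal.finite_factors`). [folklore] -/
theorem finite_setOf_mem_asIdeal {r : 𝓞 K} (hr : r ≠ 0) :
    {v : HeightOneSpectrum (𝓞 K) | r ∈ v.asIdeal}.Finite := by
  have h := Ideal.finite_factors (R := 𝓞 K) (I := Ideal.span {r})
    (by rwa [Ne, Ideal.zero_eq_bot, Ideal.span_singleton_eq_bot])
  convert h using 2 with v
  simp [Ideal.dvd_span_singleton]

/-- **Hilbert reciprocity, finiteness half** (O'Meara, Thm. 71:18, first assertion: for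
non-zero `α, β` in an algebraic number field "their Hilbert symbol is `1` for almost all `𝔭`"):
for `a b ≠ 0` in a number field `K`, the set of finite places `v` with `(a, b)_v = -1` (symbol
computed in `v.adicCompletion K`) is finite. Proof: replacing `a, b` by `a c², b d²` with
integral `a₁ = a c²`, `b₁ = b d²` (`hilbertSymbol_mul_sq_left/right`), every place `v` not
containing `2 a₁ b₁` has `(a, b)_v = (a₁, b₁)_v = 1` by `hilbertSymbol_eq_one_of_not_mem`
(O'Meara 63:12). This proves the first conjunct of the named fact `hilbertReciprocity K a b`.
[cite: Omeara1963, §71 Thm. 71:18 (first assertion)] -/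
theorem finite_setOf_hilbertSymbol_eq_neg_one {a b : K} (ha : a ≠ 0) (hb : b ≠ 0) :
    {v : HeightOneSpectrum (𝓞 K) |
      hilbertSymbol (v.adicCompletion K) (algebraMap K _ a) (algebraMap K _ b) = -1}.Finite := by
  obtain ⟨a₁, ca, ha₁, hca, hae⟩ := exists_mul_sq_eq_algebraMap K ha
  obtain ⟨b₁, cb, hb₁, hcb, hbe⟩ := exists_mul_sq_eq_algebraMap K hb
  have h2 : (2 : 𝓞 K) ≠ 0 := two_ne_zero
  refine (((finite_setOf_mem_asIdeal K ha₁).union (finite_setOf_mem_asIdeal K hb₁)).union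
    (finite_setOf_mem_asIdeal K h2)).subset fun v hv ↦ ?_
  by_contra hnot
  simp only [Set.mem_union, Set.mem_setOf_eq, not_or] at hnot
  obtain ⟨⟨hva, hvb⟩, hv2⟩ := hnot
  haveI : v.asIdeal.IsMaximal := v.isMaximal
  haveI : Finite (𝓞 K ⧸ v.asIdeal) := Ideal.finiteQuotientOfFreeOfNeBot _ v.ne_bot
  have key := hilbertSymbol_eq_one_of_not_mem K v hv2 hva hvb
  rw [Set.mem_setOf_eq] at hv
  have hca' : algebraMap K (v.adicCompletion K) ca ≠ 0 := (_root_.map_ne_zero _).2 hca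
  have hcb' : algebraMap K (v.adicCompletion K) cb ≠ 0 := (_root_.map_ne_zero _).2 hcb
  rw [← hilbertSymbol_mul_sq_left _ _ hca', ← hilbertSymbol_mul_sq_right _ _ hcb',
    ← map_pow, ← map_mul, ← map_pow, ← map_mul, hae, hbe,
    ← IsScalarTower.algebraMap_apply, ← IsScalarTower.algebraMap_apply] at hv
  exact absurd (key.symm.trans hv) (by norm_num)

end NumberField

end Literature.NumberTheory.QuadraticForms
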